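import Literature.MathematicalPhysics.QuantumFieldTheory.ConformalBootstrap3D.BlockCoefficientExistence
import Mathlib.Analysis.Calculus.SmoothSeries
import Mathlib.Analysis.SpecialFunctions.Pow.Deriv
import Mathlib.Analysis.SpecificLimits.Normed
import Mathlib.Analysis.Normed.Group.InfiniteSum
import Mathlib.Topology.Algebra.InfiniteSum.Constructions
import Mathlib.Topology.Algebra.InfiniteSum.NatInt
import Mathlib.Topology.Algebra.InfiniteSum.Real
import Mathlib.Topology.Order.LiminfLimsup
import Mathlib.Algebra.Order.Antidiag.Prod
import Mathlib.Tactic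
import HarnessLib

/-!
# Extraction of the coefficient system from the Casimir equation of a 3D block, and the diagonal series

pub-ising3d REFEREE T1 (α) — the analytic step joining the *typed block predicate* to the certified
evaluator: for `g = (z z̄)^α K`, `K = Σ k_{mn} z^m z̄^n` an absolutely convergent double power series on
the unit bidisk (`IsDoublePowerSeriesOn`), the quadratic Casimir equation `CasimirEq3D` on the real square
`(0,1)²` (Dolan–Osborn 2011, §2 eqs. (2.9)–(2.12)) **forces the coefficient system**: the array `k`
satisfies the five-term monomial system `SatisfiesCoeffCasimir (-Δ₁₂/2) (Δ₃₄/2) Δ ℓ k` of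
`BlockCoefficientUniqueness` (`satisfiesCoeffCasimir_of_casimirEq3D`, `IsConformalBlock3DAbove.exists_coeff`;
only this direction is proved here). Hence `IsConformalBlock3DAbove Δ₁₂ Δ₃₄ Δ ℓ` is single-valued on
`(0,1)²` at every regular point (`IsConformalBlock3DAbove.eqOn_of_isRegular`).
Ingredients, all proved here from Mathlib: termwise differentiation of the generalised power series
`Σ_i c_i t^{w_i+β}` on `(0,1)` (`GeomSummable.hasDerivAt_gps`, dominated convergence of the derived series,
`hasDerivAt_tsum_of_isPreconnected`), the per-monomial action of the Casimir operator (the weights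
`coeffA … coeffE`), reindexing of the five shifted families, and the identity theorem for real double power
series on `(0,1)²` (`eq_zero_of_double_tsum_eq_zero`).

Consequences (equal external dimensions, `Δ` strictly above the unitarity bound, no accidental
degeneracy — every entry of a single-correlator certificate): with uniqueness (`BlockCoefficientUniqueness`)
and the Hogervorst–Rychkov identification (`BlockCoefficientExistence`) the diagonal of ANY function
satisfying the genuine predicate `IsConformalBlock3D 0 0 Δ ℓ` is the positive `ρ = z`-series
`g(x,x) = Σ_n (Σ_j B_{n,j}) x^{Δ+n} / λ_ℓ`, `λ_ℓ = binom(2ℓ,ℓ)/4^ℓ` (`IsConformalBlock3D.hasSum_diag_hr`;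
Hogervorst–Rychkov 2013, §3 eqs. (3.4), (3.9)) — the series the interval evaluator sums with a certified tail;
its partial sums are lower bounds (`IsConformalBlock3D.sum_range_le_diag`).
No claim is made at the unitarity bound or at accidental-degeneracy points (there the predicate is a limit
clause and the coefficient system is not uniquely solvable).
-/

namespace Literature.MathematicalPhysics.QuantumFieldTheory.ConformalBootstrap3D

open Set Filter Topology Finset

/-! ### Generalised power series `Σ_i c_i t^{w_i + β}` on `(0,1)`: summability and termwise derivatives -/

variable {ι : Type*}

/-- A generalised power series `t ↦ Σ_i c_i t^{w_i + β}` with natural weights `w_i` and a real exponent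
shift `β` (for a block: `ι = ℕ × ℕ`, `w = Prod.fst` or `Prod.snd`, `β = α = (Δ-ℓ)/2`). [folklore] -/
noncomputable def gps (c : ι → ℝ) (w : ι → ℕ) (β : ℝ) (t : ℝ) : ℝ :=
  ∑' i, c i * t ^ ((w i : ℝ) + β)

/-- Absolute convergence of `Σ_i c_i r^{w_i}` for every radius `r ∈ [0,1)`. [folklore] -/
def GeomSummable (c : ι → ℝ) (w : ι → ℕ) : Prop :=
  ∀ r : ℝ, 0 ≤ r → r < 1 → Summable fun i => |c i| * r ^ (w i)

/-- `n ρ^n` is bounded for `0 ≤ ρ < 1`. [folklore] -/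
theorem exists_bound_nat_mul_pow {ρ : ℝ} (h0 : 0 ≤ ρ) (h1 : ρ < 1) :
    ∃ C : ℝ, 0 ≤ C ∧ ∀ n : ℕ, (n : ℝ) * ρ ^ n ≤ C := by
  have ht : Tendsto (fun n : ℕ => (n : ℝ) * ρ ^ n) atTop (𝓝 0) :=
    tendsto_self_mul_const_pow_of_abs_lt_one (by rwa [abs_of_nonneg h0])
  obtain ⟨C, hC⟩ := ht.bddAbove_range
  refine ⟨max C 0, le_max_right _ _, fun n => le_trans ?_ (le_max_left _ _)⟩
  exact hC ⟨n, rfl⟩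

/-- Polynomial weights are absorbed by a smaller radius: `GeomSummable` is stable under
`c_i ↦ c_i (w_i + B)`. [folklore] -/
theorem GeomSummable.mul_weight {c : ι → ℝ} {w : ι → ℕ} (h : GeomSummable c w) (B : ℝ) :
    GeomSummable (fun i => c i * ((w i : ℝ) + B)) w := by
  intro r hr0 hr1
  set r' := (r + 1) / 2 with hr'
  have hr'0 : 0 < r' := by rw [hr']; linarith
  have hr'1 : r' < 1 := by rw [hr']; linarith
  have hrr' : r < r' := by rw [hr']; linarith
  have hρ0 : 0 ≤ r / r' := div_nonneg hr0 hr'0.le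
  have hρ1 : r / r' < 1 := (div_lt_one hr'0).mpr hrr'
  obtain ⟨C, hC0, hC⟩ := exists_bound_nat_mul_pow hρ0 hρ1
  have hs := h r' hr'0.le hr'1
  refine Summable.of_nonneg_of_le (fun i => by positivity) (fun i => ?_) (hs.mul_right (C + |B|))
  have hw : (w i : ℝ) * r ^ (w i) ≤ C * r' ^ (w i) := by
    have : r ^ (w i) = (r / r') ^ (w i) * r' ^ (w i) := by
      rw [← mul_pow, div_mul_cancel₀ _ hr'0.ne']
    rw [this, ← mul_assoc]
    exact mul_le_mul_of_nonneg_right (hC (w i)) (pow_nonneg hr'0.le _)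
  have hB : |B| * r ^ (w i) ≤ |B| * r' ^ (w i) :=
    mul_le_mul_of_nonneg_left (pow_le_pow_left₀ hr0 hrr'.le _) (abs_nonneg B)
  have habs : |(w i : ℝ) + B| ≤ (w i : ℝ) + |B| := by
    calc |(w i : ℝ) + B| ≤ |(w i : ℝ)| + |B| := abs_add_le _ _
      _ = (w i : ℝ) + |B| := by rw [Nat.abs_cast]
  calc |c i * ((w i : ℝ) + B)| * r ^ (w i)
      = |c i| * (|(w i : ℝ) + B| * r ^ (w i)) := by rw [abs_mul, mul_assoc]
    _ ≤ |c i| * (((w i : ℝ) + |B|) * r ^ (w i)) :=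
        mul_le_mul_of_nonneg_left (mul_le_mul_of_nonneg_right habs (pow_nonneg hr0 _))
          (abs_nonneg _)
    _ = |c i| * ((w i : ℝ) * r ^ (w i) + |B| * r ^ (w i)) := by ring
    _ ≤ |c i| * (C * r' ^ (w i) + |B| * r' ^ (w i)) :=
        mul_le_mul_of_nonneg_left (add_le_add hw hB) (abs_nonneg _)
    _ = |c i| * r' ^ (w i) * (C + |B|) := by ring

/-- Absolute convergence of the generalised power series at a point of `(0,1)`. [folklore] -/
theorem GeomSummable.summable_abs_rpow {c : ι → ℝ} {w : ι → ℕ} (h : GeomSummable c w) {t : ℝ}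
    (ht0 : 0 < t) (ht1 : t < 1) (β : ℝ) :
    Summable fun i => |c i| * t ^ ((w i : ℝ) + β) := by
  refine ((h t ht0.le ht1).mul_right (t ^ β)).congr fun i => ?_
  rw [Real.rpow_add ht0, Real.rpow_natCast]; ring

/-- Convergence of the generalised power series at a point of `(0,1)`. [folklore] -/
theorem GeomSummable.summable_rpow {c : ι → ℝ} {w : ι → ℕ} (h : GeomSummable c w) {t : ℝ}
    (ht0 : 0 < t) (ht1 : t < 1) (β : ℝ) :
    Summable fun i => c i * t ^ ((w i : ℝ) + β) :=
  (h.summable_abs_rpow ht0 ht1 β).of_norm_bounded fun i => by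
    rw [Real.norm_eq_abs, abs_mul, abs_of_nonneg (Real.rpow_nonneg ht0.le _)]

/-- `HasSum` form of the definition of `gps`. [folklore] -/
theorem GeomSummable.hasSum_gps {c : ι → ℝ} {w : ι → ℕ} (h : GeomSummable c w) {t : ℝ}
    (ht0 : 0 < t) (ht1 : t < 1) (β : ℝ) :
    HasSum (fun i => c i * t ^ ((w i : ℝ) + β)) (gps c w β t) :=
  (h.summable_rpow ht0 ht1 β).hasSum

/-- **Termwise differentiation** of `Σ_i c_i t^{w_i+β}` on `(0,1)`: the derivative is the generalised
power series with coefficients `c_i (w_i + β)` and shift `β - 1` (dominated convergence of the derived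
series on a neighbourhood `(z/2, (1+z)/2)`). [folklore] -/
theorem GeomSummable.hasDerivAt_gps {c : ι → ℝ} {w : ι → ℕ} (h : GeomSummable c w) (β : ℝ)
    {z : ℝ} (hz : z ∈ Ioo (0 : ℝ) 1) :
    HasDerivAt (gps c w β) (gps (fun i => c i * ((w i : ℝ) + β)) w (β - 1) z) z := by
  obtain ⟨hz0, hz1⟩ := hz
  set ε := z / 2 with hε
  set r := (z + 1) / 2 with hr
  have hε0 : 0 < ε := by rw [hε]; linarith
  have hεz : ε < z := by rw [hε]; linarith
  have hzr : z < r := by rw [hr]; linarith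
  have hr1 : r < 1 := by rw [hr]; linarith
  have hr0 : 0 < r := hε0.trans (hεz.trans hzr)
  set B := ε ^ (β - 1) + r ^ (β - 1) with hB
  have hu : Summable fun i => |c i * ((w i : ℝ) + |β|)| * r ^ (w i) * B :=
    ((h.mul_weight |β|) r hr0.le hr1).mul_right B
  have key := hasDerivAt_tsum_of_isPreconnected (t := Ioo ε r) (y₀ := z)
    (g := fun i t => c i * t ^ ((w i : ℝ) + β))
    (g' := fun i t => c i * (((w i : ℝ) + β) * t ^ ((w i : ℝ) + β - 1)))
    hu isOpen_Ioo isPreconnected_Ioo ?_ ?_ ⟨hεz, hzr⟩ (h.summable_rpow hz0 hz1 β) ⟨hεz, hzr⟩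
  · unfold gps
    refine key.congr_deriv (tsum_congr fun i => ?_)
    rw [show (w i : ℝ) + (β - 1) = (w i : ℝ) + β - 1 by ring]; ring
  · intro i y hy
    exact (Real.hasDerivAt_rpow_const (Or.inl (hε0.trans hy.1).ne')).const_mul (c i)
  · intro i y hy
    have hy0 : 0 < y := hε0.trans hy.1
    rw [Real.norm_eq_abs, abs_mul, abs_mul, abs_of_nonneg (Real.rpow_nonneg hy0.le _)]
    have h1 : |(w i : ℝ) + β| ≤ (w i : ℝ) + |β| := by
      calc |(w i : ℝ) + β| ≤ |(w i : ℝ)| + |β| := abs_add_le _ _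
        _ = (w i : ℝ) + |β| := by rw [Nat.abs_cast]
    have h2 : y ^ ((w i : ℝ) + β - 1) ≤ r ^ (w i) * B := by
      rw [show (w i : ℝ) + β - 1 = (w i : ℝ) + (β - 1) by ring, Real.rpow_add hy0,
        Real.rpow_natCast]
      refine mul_le_mul (pow_le_pow_left₀ hy0.le hy.2.le _) ?_ (Real.rpow_nonneg hy0.le _)
        (pow_nonneg hr0.le _)
      rcases le_or_gt 0 (β - 1) with hb | hb
      · calc y ^ (β - 1) ≤ r ^ (β - 1) := Real.rpow_le_rpow hy0.le hy.2.le hb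
          _ ≤ B := le_add_of_nonneg_left (Real.rpow_nonneg hε0.le _)
      · calc y ^ (β - 1) ≤ ε ^ (β - 1) := Real.rpow_le_rpow_of_nonpos hε0 hy.1.le hb.le
          _ ≤ B := le_add_of_nonneg_right (Real.rpow_nonneg hr0.le _)
    have h3 : |c i * ((w i : ℝ) + |β|)| = |c i| * ((w i : ℝ) + |β|) := by
      rw [abs_mul, abs_of_nonneg (show (0 : ℝ) ≤ (w i : ℝ) + |β| by positivity)]
    rw [h3]
    calc |c i| * (|(w i : ℝ) + β| * y ^ ((w i : ℝ) + β - 1))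
        ≤ |c i| * (((w i : ℝ) + |β|) * (r ^ (w i) * B)) :=
          mul_le_mul_of_nonneg_left (mul_le_mul h1 h2 (Real.rpow_nonneg hy0.le _) (by positivity))
            (abs_nonneg _)
      _ = |c i| * ((w i : ℝ) + |β|) * r ^ (w i) * B := by ring

/-- The derivative of a generalised power series on `(0,1)`. [folklore] -/
theorem GeomSummable.deriv_gps {c : ι → ℝ} {w : ι → ℕ} (h : GeomSummable c w) (β : ℝ)
    {z : ℝ} (hz : z ∈ Ioo (0 : ℝ) 1) :
    deriv (gps c w β) z = gps (fun i => c i * ((w i : ℝ) + β)) w (β - 1) z :=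
  (h.hasDerivAt_gps β hz).deriv

/-- The second derivative of a generalised power series on `(0,1)`. [folklore] -/
theorem GeomSummable.deriv_deriv_gps {c : ι → ℝ} {w : ι → ℕ} (h : GeomSummable c w) (β : ℝ)
    {z : ℝ} (hz : z ∈ Ioo (0 : ℝ) 1) :
    deriv (deriv (gps c w β)) z =
      gps (fun i => c i * ((w i : ℝ) + β) * ((w i : ℝ) + (β - 1))) w (β - 1 - 1) z := by
  have h1 : deriv (gps c w β) =ᶠ[𝓝 z] gps (fun i => c i * ((w i : ℝ) + β)) w (β - 1) :=
    Filter.eventuallyEq_of_mem (Ioo_mem_nhds hz.1 hz.2) fun y hy => h.deriv_gps β hy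
  rw [h1.deriv_eq]
  exact ((h.mul_weight β).hasDerivAt_gps (β - 1) hz).deriv

/-- `dolanOsbornD` only sees the germ of `f` at `x`. [folklore] -/
theorem dolanOsbornD_congr_of_eventuallyEq {f₁ f₂ : ℝ → ℝ} {x : ℝ} (h : f₁ =ᶠ[𝓝 x] f₂)
    (a b : ℝ) : dolanOsbornD a b f₁ x = dolanOsbornD a b f₂ x := by
  have hd : deriv f₁ =ᶠ[𝓝 x] deriv f₂ := h.deriv
  unfold dolanOsbornD
  rw [h.deriv_eq, hd.deriv_eq, h.eq_of_nhds]

/-- `dolanOsbornD` of a generalised power series on `(0,1)`, termwise. [folklore] -/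
theorem GeomSummable.dolanOsbornD_gps {c : ι → ℝ} {w : ι → ℕ} (h : GeomSummable c w) (a b β : ℝ)
    {z : ℝ} (hz : z ∈ Ioo (0 : ℝ) 1) :
    dolanOsbornD a b (gps c w β) z =
      z ^ 2 * (1 - z) * gps (fun i => c i * ((w i : ℝ) + β) * ((w i : ℝ) + (β - 1))) w (β - 1 - 1) z
        - (a + b + 1) * z ^ 2 * gps (fun i => c i * ((w i : ℝ) + β)) w (β - 1) z
        - a * b * z * gps c w β z := by
  unfold dolanOsbornD
  rw [h.deriv_deriv_gps β hz, h.deriv_gps β hz]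



/-! ### Identity theorem for real (double) power series on `(0,1)` -/

/-- **Identity theorem, one variable.** If `Σ_P e_P z^P` converges and vanishes for all `z ∈ (0, r₀)`,
then every `e_P = 0` (peel off the lowest coefficient and let `z → 0`). [folklore] -/
theorem eq_zero_of_tsum_mul_pow_eq_zero (e : ℕ → ℝ) {r₀ : ℝ} (hr₀ : 0 < r₀)
    (h : ∀ z : ℝ, 0 < z → z < r₀ → Summable (fun P => e P * z ^ P) ∧ ∑' P, e P * z ^ P = 0) :
    e = 0 := by
  set r₁ := r₀ / 2 with hr₁
  have hr₁0 : 0 < r₁ := by rw [hr₁]; linarith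
  have hr₁r : r₁ < r₀ := by rw [hr₁]; linarith
  have habs : Summable fun P => |e P| * r₁ ^ P := by
    refine (summable_abs_iff.mpr (h r₁ hr₁0 hr₁r).1).congr fun P => ?_
    rw [abs_mul, abs_of_nonneg (pow_nonneg hr₁0.le _)]
  suffices H : ∀ N, e N = 0 from funext H
  intro N
  induction N using Nat.strong_induction_on with
  | _ N ih =>
  have hM : Summable fun i => |e (i + (N + 1))| * r₁ ^ i := by
    have h1 := (summable_nat_add_iff (N + 1)).mpr habs
    refine (h1.mul_right ((r₁ ^ (N + 1))⁻¹)).congr fun i => ?_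
    rw [pow_add]; field_simp
  set M := ∑' i, |e (i + (N + 1))| * r₁ ^ i with hMdef
  have hM0 : 0 ≤ M := tsum_nonneg fun i => by positivity
  have key : ∀ z : ℝ, 0 < z → z ≤ r₁ → |e N| ≤ z * M := by
    intro z hz0 hz1
    obtain ⟨hsz, hz⟩ := h z hz0 (lt_of_le_of_lt hz1 hr₁r)
    have hsplit := hsz.sum_add_tsum_nat_add N
    have hzero : ∑ i ∈ range N, e i * z ^ i = 0 := by
      refine Finset.sum_eq_zero fun i hi => ?_
      rw [ih i (Finset.mem_range.mp hi)]; simp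
    rw [hzero, zero_add, hz] at hsplit
    have hs2 : Summable fun i => e (i + N) * z ^ (i + N) := (summable_nat_add_iff N).mpr hsz
    have hsplit2 := hs2.tsum_eq_zero_add
    rw [hsplit] at hsplit2
    simp only [zero_add] at hsplit2
    -- hsplit2 : 0 = e N * z ^ N + ∑' i, e (i + 1 + N) * z ^ (i + 1 + N)
    have hg : HasSum (fun i => z ^ (N + 1) * (|e (i + (N + 1))| * r₁ ^ i)) (z ^ (N + 1) * M) :=
      hM.hasSum.mul_left _
    have htail := tsum_of_norm_bounded hg (f := fun i => e (i + 1 + N) * z ^ (i + 1 + N))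
      fun i => by
        rw [Real.norm_eq_abs, abs_mul, abs_of_nonneg (pow_nonneg hz0.le _),
          show i + 1 + N = i + (N + 1) by ring, pow_add, mul_comm (z ^ i), ← mul_assoc, ← mul_assoc,
          mul_comm (z ^ (N + 1))]
        refine mul_le_mul_of_nonneg_left (pow_le_pow_left₀ hz0.le hz1 _) (by positivity)
    rw [Real.norm_eq_abs] at htail
    have hEN : e N * z ^ N = -∑' i, e (i + 1 + N) * z ^ (i + 1 + N) := by linarith
    have h3 : |e N| * z ^ N ≤ z ^ (N + 1) * M := by
      rw [← abs_of_nonneg (pow_nonneg hz0.le N), ← abs_mul, hEN, abs_neg]; exact htail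
    rw [pow_succ] at h3
    have hzN : 0 < z ^ N := pow_pos hz0 N
    nlinarith
  by_contra hne
  have hpos : 0 < |e N| := abs_pos.mpr hne
  set z := min r₁ (|e N| / (2 * (M + 1))) with hzdef
  have hz0 : 0 < z := lt_min hr₁0 (by positivity)
  have h1 := key z hz0 (min_le_left _ _)
  have h2 : z * M ≤ |e N| / (2 * (M + 1)) * M := mul_le_mul_of_nonneg_right (min_le_right _ _) hM0
  have h3 : |e N| / (2 * (M + 1)) * M < |e N| := by
    rw [div_mul_eq_mul_div, div_lt_iff₀ (by positivity)]
    nlinarith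
  linarith

/-- **Identity theorem, two variables.** If `Σ_{P,Q} L_{PQ} z^P z̄^Q` converges (absolutely) and vanishes
on the open square `(0,1)²`, then `L = 0` (twice the one-variable statement, via Fubini for absolutely
convergent double series). [folklore] -/
theorem eq_zero_of_double_tsum_eq_zero (L : ℕ × ℕ → ℝ)
    (h : ∀ z zb : ℝ, 0 < z → z < 1 → 0 < zb → zb < 1 →
      Summable (fun q : ℕ × ℕ => L q * z ^ q.1 * zb ^ q.2) ∧
        ∑' q : ℕ × ℕ, L q * z ^ q.1 * zb ^ q.2 = 0) :
    L = 0 := by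
  have step1 : ∀ zb : ℝ, 0 < zb → zb < 1 → ∀ P, ∑' Q, L (P, Q) * zb ^ Q = 0 := by
    intro zb hzb0 hzb1
    have := eq_zero_of_tsum_mul_pow_eq_zero (fun P => ∑' Q, L (P, Q) * zb ^ Q) one_pos ?_
    · exact fun P => congrFun this P
    intro z hz0 hz1
    obtain ⟨hs, ht⟩ := h z zb hz0 hz1 hzb0 hzb1
    have hrow : ∀ P, (∑' Q, L (P, Q) * zb ^ Q) * z ^ P = ∑' Q, L (P, Q) * z ^ P * zb ^ Q := by
      intro P
      rw [← tsum_mul_right]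
      exact tsum_congr fun Q => by ring
    constructor
    · exact hs.prod.congr fun P => (hrow P).symm
    · calc ∑' P, (∑' Q, L (P, Q) * zb ^ Q) * z ^ P
          = ∑' P, ∑' Q, L (P, Q) * z ^ P * zb ^ Q := tsum_congr fun P => hrow P
        _ = ∑' q : ℕ × ℕ, L q * z ^ q.1 * zb ^ q.2 := hs.tsum_prod.symm
        _ = 0 := ht
  funext ⟨P, Q⟩
  have := eq_zero_of_tsum_mul_pow_eq_zero (fun Q => L (P, Q)) one_pos ?_
  · simpa using congrFun this Q
  intro zb hzb0 hzb1
  refine ⟨?_, step1 zb hzb0 hzb1 P⟩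
  obtain ⟨hs, -⟩ := h (1 / 2) zb (by norm_num) (by norm_num) hzb0 hzb1
  refine ((hs.prod_factor P).mul_right ((((1 : ℝ) / 2) ^ P)⁻¹)).congr fun Q => ?_
  field_simp

/-- **Antidiagonal resummation** of an absolutely convergent double series over `ℕ × ℕ`:
`Σ_p F p = Σ_N Σ_{p ∈ antidiagonal N} F p`. [folklore] -/
theorem hasSum_sum_antidiagonal_of_summable {F : ℕ × ℕ → ℝ} (hF : Summable F) :
    HasSum (fun N => ∑ p ∈ antidiagonal N, F p) (∑' p, F p) := by
  have h1 : HasSum (F ∘ Finset.HasAntidiagonal.sigmaAntidiagonalEquivProd) (∑' p, F p) :=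
    (Equiv.hasSum_iff Finset.HasAntidiagonal.sigmaAntidiagonalEquivProd).mpr hF.hasSum
  refine h1.sigma fun N => ?_
  have h2 := hasSum_fintype (fun c : antidiagonal N => F c)
  rw [Finset.sum_coe_sort] at h2
  convert h2 using 1
  funext c
  simp [Finset.HasAntidiagonal.sigmaAntidiagonalEquivProd]

/-! ### Reindexing the five shifted families -/

/-- The shift `(m,n) ↦ (m+i, n+j)` of `ℕ × ℕ` is injective. [folklore] -/
theorem shift_injective (i j : ℕ) : Function.Injective (fun p : ℕ × ℕ => (p.1 + i, p.2 + j)) := by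
  intro p p' h
  simp only [Prod.mk.injEq] at h
  exact Prod.ext (by omega) (by omega)

/-- Off the range of the shift the guarded pushforward vanishes. [folklore] -/
theorem shift_guard_eq_zero (i j : ℕ) (G : ℕ × ℕ → ℝ) :
    ∀ q ∉ Set.range (fun p : ℕ × ℕ => (p.1 + i, p.2 + j)),
      (fun q : ℕ × ℕ => if i ≤ q.1 ∧ j ≤ q.2 then G q else 0) q = 0 := by
  intro q hq
  simp only
  rw [if_neg]
  rintro ⟨h1, h2⟩
  exact hq ⟨(q.1 - i, q.2 - j), by ext <;> simp <;> omega⟩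

/-- **Reindexing a shifted family (HasSum form).** [folklore] -/
theorem hasSum_shift {G : ℕ × ℕ → ℝ} {i j : ℕ} {s : ℝ}
    (h : HasSum (fun p : ℕ × ℕ => G (p.1 + i, p.2 + j)) s) :
    HasSum (fun q : ℕ × ℕ => if i ≤ q.1 ∧ j ≤ q.2 then G q else 0) s := by
  refine ((shift_injective i j).hasSum_iff (shift_guard_eq_zero i j G)).mp ?_
  convert h using 1
  funext p
  simp

/-- Shift `(1,0)`. [folklore] -/
theorem hasSum_shift10 {G : ℕ × ℕ → ℝ} {s : ℝ} (h : HasSum (fun p : ℕ × ℕ => G (p.1 + 1, p.2)) s) :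
    HasSum (fun q : ℕ × ℕ => if 1 ≤ q.1 then G q else 0) s := by
  have := hasSum_shift (i := 1) (j := 0) (G := G) (by simpa using h)
  simpa using this

/-- Shift `(0,1)`. [folklore] -/
theorem hasSum_shift01 {G : ℕ × ℕ → ℝ} {s : ℝ} (h : HasSum (fun p : ℕ × ℕ => G (p.1, p.2 + 1)) s) :
    HasSum (fun q : ℕ × ℕ => if 1 ≤ q.2 then G q else 0) s := by
  have := hasSum_shift (i := 0) (j := 1) (G := G) (by simpa using h)
  simpa using this

/-- Shift `(2,0)`. [folklore] -/
theorem hasSum_shift20 {G : ℕ × ℕ → ℝ} {s : ℝ} (h : HasSum (fun p : ℕ × ℕ => G (p.1 + 2, p.2)) s) :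
    HasSum (fun q : ℕ × ℕ => if 2 ≤ q.1 then G q else 0) s := by
  have := hasSum_shift (i := 2) (j := 0) (G := G) (by simpa using h)
  simpa using this

/-- Shift `(1,1)`. [folklore] -/
theorem hasSum_shift11 {G : ℕ × ℕ → ℝ} {s : ℝ}
    (h : HasSum (fun p : ℕ × ℕ => G (p.1 + 1, p.2 + 1)) s) :
    HasSum (fun q : ℕ × ℕ => if 1 ≤ q.1 ∧ 1 ≤ q.2 then G q else 0) s :=
  hasSum_shift (i := 1) (j := 1) (G := G) h

/-- Shift `(0,2)`. [folklore] -/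
theorem hasSum_shift02 {G : ℕ × ℕ → ℝ} {s : ℝ} (h : HasSum (fun p : ℕ × ℕ => G (p.1, p.2 + 2)) s) :
    HasSum (fun q : ℕ × ℕ => if 2 ≤ q.2 then G q else 0) s := by
  have := hasSum_shift (i := 0) (j := 2) (G := G) (by simpa using h)
  simpa using this

/-! ### The coefficient array of `K`: summable families -/

/-- Dropping the absolute values in a `GeomSummable` family. [folklore] -/
theorem GeomSummable.summable_mul_pow {c : ι → ℝ} {w : ι → ℕ} (h : GeomSummable c w) {r : ℝ}
    (hr0 : 0 ≤ r) (hr1 : r < 1) : Summable fun i => c i * r ^ (w i) :=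
  (h r hr0 hr1).of_norm_bounded fun i => by
    rw [Real.norm_eq_abs, abs_mul, abs_of_nonneg (pow_nonneg hr0 _)]

variable {k : ℕ × ℕ → ℝ} {K : ℝ → ℝ → ℝ}

/-- Absolute summability of `k_{mn} z^m z̄^n` on `[0,1)²`. [folklore] -/
theorem IsDoublePowerSeriesOn.summable_abs (hS : IsDoublePowerSeriesOn k K) {z zb : ℝ}
    (hz0 : 0 ≤ z) (hz1 : z < 1) (hzb0 : 0 ≤ zb) (hzb1 : zb < 1) :
    Summable fun p : ℕ × ℕ => |k p| * z ^ p.1 * zb ^ p.2 := by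
  have h := (hS z zb (by rwa [abs_of_nonneg hz0]) (by rwa [abs_of_nonneg hzb0])).1
  simpa only [abs_of_nonneg hz0, abs_of_nonneg hzb0] using h

/-- Summability of `k_{mn} z^m z̄^n` on `[0,1)²`. [folklore] -/
theorem IsDoublePowerSeriesOn.summable (hS : IsDoublePowerSeriesOn k K) {z zb : ℝ}
    (hz0 : 0 ≤ z) (hz1 : z < 1) (hzb0 : 0 ≤ zb) (hzb1 : zb < 1) :
    Summable fun p : ℕ × ℕ => k p * z ^ p.1 * zb ^ p.2 :=
  (hS.summable_abs hz0 hz1 hzb0 hzb1).of_norm_bounded fun p => by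
    rw [Real.norm_eq_abs, abs_mul, abs_mul, abs_of_nonneg (pow_nonneg hz0 _),
      abs_of_nonneg (pow_nonneg hzb0 _)]

/-- The value of `K` on `[0,1)²` is the double sum. [folklore] -/
theorem IsDoublePowerSeriesOn.eq_tsum (hS : IsDoublePowerSeriesOn k K) {z zb : ℝ}
    (hz0 : 0 ≤ z) (hz1 : z < 1) (hzb0 : 0 ≤ zb) (hzb1 : zb < 1) :
    K z zb = ∑' p : ℕ × ℕ, k p * z ^ p.1 * zb ^ p.2 :=
  (hS z zb (by rwa [abs_of_nonneg hz0]) (by rwa [abs_of_nonneg hzb0])).2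

/-- For fixed `z̄ ∈ [0,1)`, `(k_{mn} u z̄^n)` is `GeomSummable` in the weight `m`. [folklore] -/
theorem IsDoublePowerSeriesOn.geomSummable_fst (hS : IsDoublePowerSeriesOn k K) {zb : ℝ}
    (hzb0 : 0 ≤ zb) (hzb1 : zb < 1) (u : ℝ) :
    GeomSummable (fun p : ℕ × ℕ => k p * (u * zb ^ p.2)) Prod.fst := by
  intro r hr0 hr1
  refine ((hS.summable_abs hr0 hr1 hzb0 hzb1).mul_left |u|).congr fun p => ?_
  rw [abs_mul, abs_mul, abs_of_nonneg (pow_nonneg hzb0 _)]; ring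

/-- For fixed `z ∈ [0,1)`, `(k_{mn} u z^m)` is `GeomSummable` in the weight `n`. [folklore] -/
theorem IsDoublePowerSeriesOn.geomSummable_snd (hS : IsDoublePowerSeriesOn k K) {z : ℝ}
    (hz0 : 0 ≤ z) (hz1 : z < 1) (u : ℝ) :
    GeomSummable (fun p : ℕ × ℕ => k p * (u * z ^ p.1)) Prod.snd := by
  intro r hr0 hr1
  refine ((hS.summable_abs hz0 hz1 hr0 hr1).mul_left |u|).congr fun p => ?_
  rw [abs_mul, abs_mul, abs_of_nonneg (pow_nonneg hz0 _)]; ring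

section Weights

variable (hS : IsDoublePowerSeriesOn k K) {z zb : ℝ}
  (hz0 : 0 ≤ z) (hz1 : z < 1) (hzb0 : 0 ≤ zb) (hzb1 : zb < 1)
include hS hz0 hz1 hzb0 hzb1

/-- Weight `1`. [folklore] -/
theorem IsDoublePowerSeriesOn.summable_w0 :
    Summable fun p : ℕ × ℕ => k p * (z ^ p.1 * zb ^ p.2) := by
  refine ((hS.geomSummable_fst hzb0 hzb1 1).summable_mul_pow hz0 hz1).congr fun p => ?_
  ring

/-- Weight `m + B₁`. [folklore] -/
theorem IsDoublePowerSeriesOn.summable_fst_w1 (B₁ : ℝ) :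
    Summable fun p : ℕ × ℕ => k p * ((p.1 : ℝ) + B₁) * (z ^ p.1 * zb ^ p.2) := by
  refine (((hS.geomSummable_fst hzb0 hzb1 1).mul_weight B₁).summable_mul_pow hz0 hz1).congr
    fun p => ?_
  ring

/-- Weight `(m + B₁)(m + B₂)`. [folklore] -/
theorem IsDoublePowerSeriesOn.summable_fst_w2 (B₁ B₂ : ℝ) :
    Summable fun p : ℕ × ℕ => k p * (((p.1 : ℝ) + B₁) * ((p.1 : ℝ) + B₂)) * (z ^ p.1 * zb ^ p.2) := by
  refine ((((hS.geomSummable_fst hzb0 hzb1 1).mul_weight B₁).mul_weight B₂).summable_mul_pow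
    hz0 hz1).congr fun p => ?_
  ring

/-- Weight `n + B₁`. [folklore] -/
theorem IsDoublePowerSeriesOn.summable_snd_w1 (B₁ : ℝ) :
    Summable fun p : ℕ × ℕ => k p * ((p.2 : ℝ) + B₁) * (z ^ p.1 * zb ^ p.2) := by
  refine (((hS.geomSummable_snd hz0 hz1 1).mul_weight B₁).summable_mul_pow hzb0 hzb1).congr
    fun p => ?_
  ring

/-- Weight `(n + B₁)(n + B₂)`. [folklore] -/
theorem IsDoublePowerSeriesOn.summable_snd_w2 (B₁ B₂ : ℝ) :
    Summable fun p : ℕ × ℕ => k p * (((p.2 : ℝ) + B₁) * ((p.2 : ℝ) + B₂)) * (z ^ p.1 * zb ^ p.2) := by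
  refine ((((hS.geomSummable_snd hz0 hz1 1).mul_weight B₁).mul_weight B₂).summable_mul_pow
    hzb0 hzb1).congr fun p => ?_
  ring

/-- The `A`-family `A(m,n) k_{mn} z^{m+1} z̄^n` is summable. [folklore] -/
theorem IsDoublePowerSeriesOn.summable_pieceA (Δ : ℝ) (ℓ : ℕ) :
    Summable fun p : ℕ × ℕ => coeffA Δ ℓ p.1 p.2 * k p * z ^ (p.1 + 1) * zb ^ p.2 := by
  have h1 := hS.summable_fst_w2 hz0 hz1 hzb0 hzb1 (halfTwist Δ ℓ) (halfTwist Δ ℓ - 1)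
  have h2 := hS.summable_snd_w2 hz0 hz1 hzb0 hzb1 (halfTwist Δ ℓ) (halfTwist Δ ℓ - 1)
  have h3 := hS.summable_w0 hz0 hz1 hzb0 hzb1
  have h4 := hS.summable_snd_w1 hz0 hz1 hzb0 hzb1 (halfTwist Δ ℓ)
  refine ((((h1.add h2).sub (h3.mul_left (casimirEigenvalue3D Δ ℓ))).sub h4).mul_left z).congr
    fun p => ?_
  simp only [coeffA]; ring

/-- The `B`-family `B(m,n) k_{mn} z^m z̄^{n+1}` is summable. [folklore] -/
theorem IsDoublePowerSeriesOn.summable_pieceB (Δ : ℝ) (ℓ : ℕ) :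
    Summable fun p : ℕ × ℕ => coeffB Δ ℓ p.1 p.2 * k p * z ^ p.1 * zb ^ (p.2 + 1) := by
  have h1 := hS.summable_fst_w2 hz0 hz1 hzb0 hzb1 (halfTwist Δ ℓ) (halfTwist Δ ℓ - 1)
  have h2 := hS.summable_snd_w2 hz0 hz1 hzb0 hzb1 (halfTwist Δ ℓ) (halfTwist Δ ℓ - 1)
  have h3 := hS.summable_w0 hz0 hz1 hzb0 hzb1
  have h5 := hS.summable_fst_w1 hz0 hz1 hzb0 hzb1 (halfTwist Δ ℓ)
  refine ((((h1.add h2).sub (h3.mul_left (casimirEigenvalue3D Δ ℓ))).neg.add h5).mul_left zb).congr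
    fun p => ?_
  simp only [coeffB]; ring

/-- The `C`-family `C(m) k_{mn} z^{m+2} z̄^n` is summable. [folklore] -/
theorem IsDoublePowerSeriesOn.summable_pieceC (a b Δ : ℝ) (ℓ : ℕ) :
    Summable fun p : ℕ × ℕ => coeffC a b Δ ℓ p.1 * k p * z ^ (p.1 + 2) * zb ^ p.2 := by
  have h6 := hS.summable_fst_w2 hz0 hz1 hzb0 hzb1 (halfTwist Δ ℓ + a) (halfTwist Δ ℓ + b)
  refine (h6.neg.mul_left (z ^ 2)).congr fun p => ?_
  simp only [coeffC]; ring

/-- The `D`-family `D(m,n) k_{mn} z^{m+1} z̄^{n+1}` is summable. [folklore] -/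
theorem IsDoublePowerSeriesOn.summable_pieceD (a b Δ : ℝ) (ℓ : ℕ) :
    Summable fun p : ℕ × ℕ =>
      coeffD a b Δ ℓ p.1 p.2 * k p * z ^ (p.1 + 1) * zb ^ (p.2 + 1) := by
  have h6 := hS.summable_fst_w2 hz0 hz1 hzb0 hzb1 (halfTwist Δ ℓ + a) (halfTwist Δ ℓ + b)
  have h7 := hS.summable_snd_w2 hz0 hz1 hzb0 hzb1 (halfTwist Δ ℓ + a) (halfTwist Δ ℓ + b)
  have h5 := hS.summable_fst_w1 hz0 hz1 hzb0 hzb1 (halfTwist Δ ℓ)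
  have h4 := hS.summable_snd_w1 hz0 hz1 hzb0 hzb1 (halfTwist Δ ℓ)
  refine ((((h6.sub h7).sub h5).add h4).mul_left (z * zb)).congr fun p => ?_
  simp only [coeffD]; ring

/-- The `E`-family `E(n) k_{mn} z^m z̄^{n+2}` is summable. [folklore] -/
theorem IsDoublePowerSeriesOn.summable_pieceE (a b Δ : ℝ) (ℓ : ℕ) :
    Summable fun p : ℕ × ℕ => coeffE a b Δ ℓ p.2 * k p * z ^ p.1 * zb ^ (p.2 + 2) := by
  have h7 := hS.summable_snd_w2 hz0 hz1 hzb0 hzb1 (halfTwist Δ ℓ + a) (halfTwist Δ ℓ + b)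
  refine (h7.mul_left (zb ^ 2)).congr fun p => ?_
  simp only [coeffE]; ring

end Weights

/-! ### The extraction theorem -/

/-- **The Casimir equation holds coefficientwise** (Dolan–Osborn 2011, §2: "substituting the expansion
into the Casimir equation gives the recurrence"). For `g = (z z̄)^{(Δ-ℓ)/2} K` with `K = Σ k_{mn} z^m z̄^n`
absolutely convergent on the unit bidisk, the quadratic Casimir equation on the open square `(0,1)²`
forces the five-term monomial system `SatisfiesCoeffCasimir (-Δ₁₂/2) (Δ₃₄/2) Δ ℓ k`. Proof: both partial
functions of `g` are generalised power series, differentiated termwise; the Casimir expression is then the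
absolutely convergent double series `(z z̄)^α Σ_{P,Q} E_{PQ} z^P z̄^Q` with
`E_{PQ} = coeffCasimirLHS … k P Q`, and a double power series vanishing on `(0,1)²` has zero coefficients.
[cite: DolanOsborn2011, §2 eqs. (2.9)–(2.12)] -/
theorem satisfiesCoeffCasimir_of_casimirEq3D {Δ₁₂ Δ₃₄ Δ : ℝ} {ℓ : ℕ} {g : ℝ → ℝ → ℝ}
    (hS : IsDoublePowerSeriesOn k K)
    (hg : ∀ z zb : ℝ, z ∈ Ioo (0 : ℝ) 1 → zb ∈ Ioo (0 : ℝ) 1 →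
      g z zb = (z * zb) ^ ((Δ - (ℓ : ℝ)) / 2) * K z zb)
    (hC : ∀ z zb : ℝ, z ∈ Ioo (0 : ℝ) 1 → zb ∈ Ioo (0 : ℝ) 1 → CasimirEq3D Δ₁₂ Δ₃₄ Δ ℓ g z zb) :
    SatisfiesCoeffCasimir (-Δ₁₂ / 2) (Δ₃₄ / 2) Δ ℓ k := by
  have hg' : ∀ z zb : ℝ, z ∈ Ioo (0 : ℝ) 1 → zb ∈ Ioo (0 : ℝ) 1 →
      g z zb = (z * zb) ^ (halfTwist Δ ℓ) * K z zb := fun z zb hz hzb => by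
    rw [hg z zb hz hzb]; rfl
  -- Step 1: on the open square, the double series `Σ_q E_q z^{q₁} z̄^{q₂}` converges to `0`.
  have main : ∀ z zb : ℝ, 0 < z → z < 1 → 0 < zb → zb < 1 →
      Summable (fun q : ℕ × ℕ =>
          coeffCasimirLHS (-Δ₁₂ / 2) (Δ₃₄ / 2) Δ ℓ k q.1 q.2 * z ^ q.1 * zb ^ q.2) ∧
        ∑' q : ℕ × ℕ, coeffCasimirLHS (-Δ₁₂ / 2) (Δ₃₄ / 2) Δ ℓ k q.1 q.2 * z ^ q.1 * zb ^ q.2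
          = 0 := by
    intro z zb hz0 hz1 hzb0 hzb1
    have hz : z ∈ Ioo (0 : ℝ) 1 := ⟨hz0, hz1⟩
    have hzb : zb ∈ Ioo (0 : ℝ) 1 := ⟨hzb0, hzb1⟩
    -- the two partial functions of `g` are generalised power series on `(0,1)`
    have G1 : GeomSummable (fun p : ℕ × ℕ => k p * (zb ^ (halfTwist Δ ℓ) * zb ^ p.2)) Prod.fst :=
      hS.geomSummable_fst hzb0.le hzb1 _
    have G2 : GeomSummable (fun p : ℕ × ℕ => k p * (z ^ (halfTwist Δ ℓ) * z ^ p.1)) Prod.snd :=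
      hS.geomSummable_snd hz0.le hz1 _
    have E1 : EqOn (fun t => g t zb)
        (gps (fun p : ℕ × ℕ => k p * (zb ^ (halfTwist Δ ℓ) * zb ^ p.2)) Prod.fst (halfTwist Δ ℓ))
        (Ioo 0 1) := by
      intro t ht
      simp only [gps]
      rw [hg' t zb ht hzb, hS.eq_tsum ht.1.le ht.2 hzb0.le hzb1, Real.mul_rpow ht.1.le hzb0.le,
        ← tsum_mul_left]
      refine tsum_congr fun p => ?_
      rw [Real.rpow_add ht.1, Real.rpow_natCast]; ring
    have E2 : EqOn (fun t => g z t)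
        (gps (fun p : ℕ × ℕ => k p * (z ^ (halfTwist Δ ℓ) * z ^ p.1)) Prod.snd (halfTwist Δ ℓ))
        (Ioo 0 1) := by
      intro t ht
      simp only [gps]
      rw [hg' z t hz ht, hS.eq_tsum hz0.le hz1 ht.1.le ht.2, Real.mul_rpow hz0.le ht.1.le,
        ← tsum_mul_left]
      refine tsum_congr fun p => ?_
      rw [Real.rpow_add ht.1, Real.rpow_natCast]; ring
    have e1 := Filter.eventuallyEq_of_mem (Ioo_mem_nhds hz0 hz1) E1
    have e2 := Filter.eventuallyEq_of_mem (Ioo_mem_nhds hzb0 hzb1) E2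
    have gz : g z zb = gps (fun p : ℕ × ℕ => k p * (zb ^ (halfTwist Δ ℓ) * zb ^ p.2)) Prod.fst
        (halfTwist Δ ℓ) z := E1 hz
    -- the Casimir equation in terms of the six generalised power series
    have hCz := hC z zb hz hzb
    unfold CasimirEq3D at hCz
    rw [dolanOsbornD_congr_of_eventuallyEq e1, dolanOsbornD_congr_of_eventuallyEq e2, e1.deriv_eq,
      e2.deriv_eq, G1.dolanOsbornD_gps _ _ _ hz, G2.dolanOsbornD_gps _ _ _ hzb, G1.deriv_gps _ hz,
      G2.deriv_gps _ hzb, gz] at hCz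
    -- the six `HasSum`s
    have hT1 := G1.hasSum_gps hz0 hz1 (halfTwist Δ ℓ)
    have hT1' := (G1.mul_weight (halfTwist Δ ℓ)).hasSum_gps hz0 hz1 (halfTwist Δ ℓ - 1)
    have hT1'' := ((G1.mul_weight (halfTwist Δ ℓ)).mul_weight (halfTwist Δ ℓ - 1)).hasSum_gps hz0 hz1
      (halfTwist Δ ℓ - 1 - 1)
    have hT2 := G2.hasSum_gps hzb0 hzb1 (halfTwist Δ ℓ)
    have hT2' := (G2.mul_weight (halfTwist Δ ℓ)).hasSum_gps hzb0 hzb1 (halfTwist Δ ℓ - 1)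
    have hT2'' := ((G2.mul_weight (halfTwist Δ ℓ)).mul_weight (halfTwist Δ ℓ - 1)).hasSum_gps hzb0
      hzb1 (halfTwist Δ ℓ - 1 - 1)
    have hL := ((((((hT1''.mul_left (z ^ 2 * (1 - z))).sub
        (hT1'.mul_left (((-Δ₁₂ / 2) + Δ₃₄ / 2 + 1) * z ^ 2))).sub
        (hT1.mul_left ((-Δ₁₂ / 2) * (Δ₃₄ / 2) * z))).add
        (((hT2''.mul_left (zb ^ 2 * (1 - zb))).sub
          (hT2'.mul_left (((-Δ₁₂ / 2) + Δ₃₄ / 2 + 1) * zb ^ 2))).sub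
          (hT2.mul_left ((-Δ₁₂ / 2) * (Δ₃₄ / 2) * zb)))).sub
        (hT1.mul_left (casimirEigenvalue3D Δ ℓ))).mul_left (z - zb)).add
      (((hT1'.mul_left (1 - z)).sub (hT2'.mul_left (1 - zb))).mul_left (z * zb))
    -- … whose sum is the Casimir expression, i.e. `0`; termwise it is `(z z̄)^α k_p Ψ_p`
    have R1 : ∀ (m : ℕ) (β : ℝ), z ^ ((m : ℝ) + β) = z ^ β * z ^ m := fun m β => by
      rw [Real.rpow_add hz0, Real.rpow_natCast, mul_comm]
    have R2 : ∀ (m : ℕ) (β : ℝ), zb ^ ((m : ℝ) + β) = zb ^ β * zb ^ m := fun m β => by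
      rw [Real.rpow_add hzb0, Real.rpow_natCast, mul_comm]
    have hzne : z ≠ 0 := hz0.ne'
    have hzbne : zb ≠ 0 := hzb0.ne'
    have h1 := hL.tsum_eq.trans (show _ = (0 : ℝ) by linear_combination hCz)
    have hc : (z * zb) ^ (halfTwist Δ ℓ) ≠ 0 := (Real.rpow_pos_of_pos (mul_pos hz0 hzb0) _).ne'
    have hval : ∑' p : ℕ × ℕ, (z * zb) ^ (halfTwist Δ ℓ) *
        (coeffA Δ ℓ p.1 p.2 * k p * z ^ (p.1 + 1) * zb ^ p.2
          + coeffB Δ ℓ p.1 p.2 * k p * z ^ p.1 * zb ^ (p.2 + 1)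
          + coeffC (-Δ₁₂ / 2) (Δ₃₄ / 2) Δ ℓ p.1 * k p * z ^ (p.1 + 2) * zb ^ p.2
          + coeffD (-Δ₁₂ / 2) (Δ₃₄ / 2) Δ ℓ p.1 p.2 * k p * z ^ (p.1 + 1) * zb ^ (p.2 + 1)
          + coeffE (-Δ₁₂ / 2) (Δ₃₄ / 2) Δ ℓ p.2 * k p * z ^ p.1 * zb ^ (p.2 + 2)) = 0 := by
      refine (tsum_congr fun p => ?_).trans h1
      simp only [R1, R2, Real.rpow_sub_one hzne, Real.rpow_sub_one hzbne,
        Real.mul_rpow hz0.le hzb0.le, coeffA, coeffB, coeffC, coeffD, coeffE]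
      field_simp
      ring
    have hval' : ∑' p : ℕ × ℕ,
        (coeffA Δ ℓ p.1 p.2 * k p * z ^ (p.1 + 1) * zb ^ p.2
          + coeffB Δ ℓ p.1 p.2 * k p * z ^ p.1 * zb ^ (p.2 + 1)
          + coeffC (-Δ₁₂ / 2) (Δ₃₄ / 2) Δ ℓ p.1 * k p * z ^ (p.1 + 2) * zb ^ p.2
          + coeffD (-Δ₁₂ / 2) (Δ₃₄ / 2) Δ ℓ p.1 p.2 * k p * z ^ (p.1 + 1) * zb ^ (p.2 + 1)
          + coeffE (-Δ₁₂ / 2) (Δ₃₄ / 2) Δ ℓ p.2 * k p * z ^ p.1 * zb ^ (p.2 + 2)) = 0 := by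
      rw [tsum_mul_left] at hval
      exact (mul_eq_zero.mp hval).resolve_left hc
    -- the five pieces and their pushforwards to the monomial `z^P z̄^Q`
    have sA := hS.summable_pieceA hz0.le hz1 hzb0.le hzb1 Δ ℓ
    have sB := hS.summable_pieceB hz0.le hz1 hzb0.le hzb1 Δ ℓ
    have sC := hS.summable_pieceC hz0.le hz1 hzb0.le hzb1 (-Δ₁₂ / 2) (Δ₃₄ / 2) Δ ℓ
    have sD := hS.summable_pieceD hz0.le hz1 hzb0.le hzb1 (-Δ₁₂ / 2) (Δ₃₄ / 2) Δ ℓ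
    have sE := hS.summable_pieceE hz0.le hz1 hzb0.le hzb1 (-Δ₁₂ / 2) (Δ₃₄ / 2) Δ ℓ
    have hsum0 : (∑' p : ℕ × ℕ, coeffA Δ ℓ p.1 p.2 * k p * z ^ (p.1 + 1) * zb ^ p.2)
        + (∑' p : ℕ × ℕ, coeffB Δ ℓ p.1 p.2 * k p * z ^ p.1 * zb ^ (p.2 + 1))
        + (∑' p : ℕ × ℕ, coeffC (-Δ₁₂ / 2) (Δ₃₄ / 2) Δ ℓ p.1 * k p * z ^ (p.1 + 2) * zb ^ p.2)
        + (∑' p : ℕ × ℕ,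
            coeffD (-Δ₁₂ / 2) (Δ₃₄ / 2) Δ ℓ p.1 p.2 * k p * z ^ (p.1 + 1) * zb ^ (p.2 + 1))
        + (∑' p : ℕ × ℕ, coeffE (-Δ₁₂ / 2) (Δ₃₄ / 2) Δ ℓ p.2 * k p * z ^ p.1 * zb ^ (p.2 + 2))
        = 0 :=
      ((((sA.hasSum.add sB.hasSum).add sC.hasSum).add sD.hasSum).add sE.hasSum).tsum_eq.symm.trans
        hval'
    have hA := hasSum_shift10
      (G := fun q : ℕ × ℕ => coeffA Δ ℓ (q.1 - 1) q.2 * k (q.1 - 1, q.2) * z ^ q.1 * zb ^ q.2)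
      (by simpa using sA.hasSum)
    have hB := hasSum_shift01
      (G := fun q : ℕ × ℕ => coeffB Δ ℓ q.1 (q.2 - 1) * k (q.1, q.2 - 1) * z ^ q.1 * zb ^ q.2)
      (by simpa using sB.hasSum)
    have hC' := hasSum_shift20
      (G := fun q : ℕ × ℕ =>
        coeffC (-Δ₁₂ / 2) (Δ₃₄ / 2) Δ ℓ (q.1 - 2) * k (q.1 - 2, q.2) * z ^ q.1 * zb ^ q.2)
      (by simpa using sC.hasSum)
    have hD := hasSum_shift11
      (G := fun q : ℕ × ℕ =>
        coeffD (-Δ₁₂ / 2) (Δ₃₄ / 2) Δ ℓ (q.1 - 1) (q.2 - 1) * k (q.1 - 1, q.2 - 1) * z ^ q.1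
          * zb ^ q.2)
      (by simpa using sD.hasSum)
    have hE := hasSum_shift02
      (G := fun q : ℕ × ℕ =>
        coeffE (-Δ₁₂ / 2) (Δ₃₄ / 2) Δ ℓ (q.2 - 2) * k (q.1, q.2 - 2) * z ^ q.1 * zb ^ q.2)
      (by simpa using sE.hasSum)
    have hq := (((hA.add hB).add hC').add hD).add hE
    rw [hsum0] at hq
    have hqL : HasSum (fun q : ℕ × ℕ =>
        coeffCasimirLHS (-Δ₁₂ / 2) (Δ₃₄ / 2) Δ ℓ k q.1 q.2 * z ^ q.1 * zb ^ q.2) 0 := by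
      convert hq using 1
      funext q
      simp only [coeffCasimirLHS, add_mul, ite_mul, zero_mul]
    exact ⟨hqL.summable, hqL.tsum_eq⟩
  -- Step 2: identity theorem.
  have hzero := eq_zero_of_double_tsum_eq_zero
    (fun q : ℕ × ℕ => coeffCasimirLHS (-Δ₁₂ / 2) (Δ₃₄ / 2) Δ ℓ k q.1 q.2) main
  intro P Q
  simpa using congrFun hzero (P, Q)

/-- **T1 (α), the referee's requested shape**: a function satisfying the generic block predicate has a
coefficient array which is a symmetric solution of the monomial Casimir system with the Dolan–Osborn
boundary row. With `SatisfiesCoeffCasimir.unique_of_isRegularPoint3D` this makes `IsConformalBlock3DAbove`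
single-valued on `(0,1)²` at every regular point. [cite: DolanOsborn2011, §2 eqs. (2.9)–(2.12)] -/
theorem IsConformalBlock3DAbove.exists_coeff {Δ₁₂ Δ₃₄ Δ : ℝ} {ℓ : ℕ} {g : ℝ → ℝ → ℝ}
    (h : IsConformalBlock3DAbove Δ₁₂ Δ₃₄ Δ ℓ g) :
    ∃ (k : ℕ × ℕ → ℝ) (K : ℝ → ℝ → ℝ), IsDoublePowerSeriesOn k K ∧
      (∀ p : ℕ × ℕ, k (p.2, p.1) = k p) ∧ HasLeadingPart ℓ k ∧
      (∀ z zb : ℝ, z ∈ Ioo (0 : ℝ) 1 → zb ∈ Ioo (0 : ℝ) 1 →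
        g z zb = (z * zb) ^ ((Δ - (ℓ : ℝ)) / 2) * K z zb) ∧
      SatisfiesCoeffCasimir (-Δ₁₂ / 2) (Δ₃₄ / 2) Δ ℓ k := by
  obtain ⟨k, K, hS, hsym, hlead, hg, hC⟩ := h
  exact ⟨k, K, hS, hsym, hlead, hg, satisfiesCoeffCasimir_of_casimirEq3D hS hg hC⟩

/-- **Uniqueness of the generic block on the square.** Two functions satisfying
`IsConformalBlock3DAbove Δ₁₂ Δ₃₄ Δ ℓ` at a point strictly above the unitarity bound and off the accidental
degeneracies agree on `(0,1)²`. [cite: HogervorstRychkov2013, §3 eq. (3.9)] -/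
theorem IsConformalBlock3DAbove.eqOn_of_isRegular {Δ₁₂ Δ₃₄ Δ : ℝ} {ℓ : ℕ} {g₁ g₂ : ℝ → ℝ → ℝ}
    (hΔ : unitarityBound3D ℓ < Δ) (hreg : ¬ accidentalDegeneracy3D Δ ℓ)
    (h₁ : IsConformalBlock3DAbove Δ₁₂ Δ₃₄ Δ ℓ g₁) (h₂ : IsConformalBlock3DAbove Δ₁₂ Δ₃₄ Δ ℓ g₂) :
    ∀ z zb : ℝ, z ∈ Ioo (0 : ℝ) 1 → zb ∈ Ioo (0 : ℝ) 1 → g₁ z zb = g₂ z zb := by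
  obtain ⟨k₁, K₁, hS₁, hsym₁, hlead₁, hg₁, hk₁⟩ := h₁.exists_coeff
  obtain ⟨k₂, K₂, hS₂, hsym₂, hlead₂, hg₂, hk₂⟩ := h₂.exists_coeff
  have hk : k₁ = k₂ := hk₁.unique hΔ hreg hk₂ hsym₁ hsym₂ hlead₁ hlead₂
  intro z zb hz hzb
  rw [hg₁ z zb hz hzb, hg₂ z zb hz hzb, hS₁.eq_tsum hz.1.le hz.2 hzb.1.le hzb.2,
    hS₂.eq_tsum hz.1.le hz.2 hzb.1.le hzb.2, hk]

/-! ### The diagonal series -/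

/-- **Diagonal resummation of `K`**: `K(x,x) = Σ_N d_N x^N`, `d_N = Σ_{m+n=N} k_{mn}` (`diagCoeff`).
[cite: HogervorstRychkov2013, §3 eq. (3.4)] -/
theorem IsDoublePowerSeriesOn.hasSum_diagCoeff (hS : IsDoublePowerSeriesOn k K) {x : ℝ}
    (hx0 : 0 ≤ x) (hx1 : x < 1) :
    HasSum (fun N : ℕ => diagCoeff k N * x ^ N) (K x x) := by
  have h := hasSum_sum_antidiagonal_of_summable (hS.summable hx0 hx1 hx0 hx1)
  rw [← hS.eq_tsum hx0 hx1 hx0 hx1] at h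
  convert h using 1
  funext N
  rw [diagCoeff, Finset.sum_mul]
  refine Finset.sum_congr rfl fun p hp => ?_
  rw [Finset.mem_antidiagonal] at hp
  rw [← hp, pow_add]; ring

/-- **The diagonal of `g = (z z̄)^{(Δ-ℓ)/2} K`** as a generalised power series:
`g(x,x) = Σ_N d_N x^{N + Δ - ℓ}` on `(0,1)`. [cite: HogervorstRychkov2013, §3 eq. (3.4)] -/
theorem hasSum_diag_of_series {Δ : ℝ} {ℓ : ℕ} {g : ℝ → ℝ → ℝ} (hS : IsDoublePowerSeriesOn k K)
    (hg : ∀ z zb : ℝ, z ∈ Ioo (0 : ℝ) 1 → zb ∈ Ioo (0 : ℝ) 1 →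
      g z zb = (z * zb) ^ ((Δ - (ℓ : ℝ)) / 2) * K z zb)
    {x : ℝ} (hx : x ∈ Ioo (0 : ℝ) 1) :
    HasSum (fun N : ℕ => diagCoeff k N * x ^ ((N : ℝ) + (Δ - (ℓ : ℝ)))) (g x x) := by
  have h := (hS.hasSum_diagCoeff hx.1.le hx.2).mul_left ((x * x) ^ ((Δ - (ℓ : ℝ)) / 2))
  rw [← hg x x hx hx] at h
  have hfun : (fun N : ℕ => diagCoeff k N * x ^ ((N : ℝ) + (Δ - (ℓ : ℝ)))) =
      fun N : ℕ => (x * x) ^ ((Δ - (ℓ : ℝ)) / 2) * (diagCoeff k N * x ^ N) := by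
    funext N
    rw [Real.mul_rpow hx.1.le hx.1.le, ← Real.rpow_add hx.1,
      show (Δ - (ℓ : ℝ)) / 2 + (Δ - (ℓ : ℝ)) / 2 = Δ - (ℓ : ℝ) by ring, Real.rpow_add hx.1,
      Real.rpow_natCast]
    ring
  rw [hfun]
  exact h

/-- **The evaluator's series (pub-ising3d REFEREE T1, `Δ₁₂ = Δ₃₄ = 0`).** For `Δ` strictly above the
unitarity bound and off the accidental degeneracies, the diagonal of any function satisfying the genuine
block predicate `IsConformalBlock3D 0 0 Δ ℓ` is the Hogervorst–Rychkov `ρ = z`-series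
`g(x,x) = Σ_n (Σ_j B_{n,j}) x^{Δ+n} / λ_ℓ` with `λ_ℓ = binom(2ℓ,ℓ)/4^ℓ`, all terms nonnegative
(`hrLevelSum_nonneg`): the coefficient array is extracted (`exists_coeff`), identified with the
Legendre-product resolution of the HR coefficients (`SatisfiesCoeffCasimir.eq_hrMonomialCoeff`), and the
diagonal resummed. [cite: HogervorstRychkov2013, §3 eqs. (3.4), (3.9)] -/
theorem IsConformalBlock3D.hasSum_diag_hr {Δ : ℝ} {ℓ : ℕ} {g : ℝ → ℝ → ℝ}
    (hΔ : unitarityBound3D ℓ < Δ) (hreg : ¬ accidentalDegeneracy3D Δ ℓ)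
    (h : IsConformalBlock3D 0 0 Δ ℓ g) {x : ℝ} (hx : x ∈ Ioo (0 : ℝ) 1) :
    HasSum (fun n : ℕ => hrLevelSum Δ ℓ n / legendreLam ℓ * x ^ (Δ + (n : ℝ))) (g x x) := by
  have hregpt : IsRegularPoint3D Δ ℓ := ⟨ne_of_gt hΔ, hreg⟩
  obtain ⟨k, K, hS, hsym, hlead, hg, hC⟩ :=
    (isConformalBlock3D_iff_above_of_isRegularPoint3D hregpt).mp h
  have hk : SatisfiesCoeffCasimir 0 0 Δ ℓ k := by
    simpa using satisfiesCoeffCasimir_of_casimirEq3D hS hg hC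
  have hkeq : k = hrMonomialCoeff Δ ℓ := hk.eq_hrMonomialCoeff hΔ hreg hsym hlead
  have hd := (hasSum_nat_add_iff' ℓ).mpr (hasSum_diag_of_series hS hg hx)
  have h0 : ∑ i ∈ range ℓ, diagCoeff k i * x ^ ((i : ℝ) + (Δ - (ℓ : ℝ))) = 0 :=
    Finset.sum_eq_zero fun i hi => by
      rw [diagCoeff_eq_zero_of_lt hk hsym hΔ (Finset.mem_range.mp hi), zero_mul]
  rw [h0, sub_zero] at hd
  have hfun : (fun n : ℕ => hrLevelSum Δ ℓ n / legendreLam ℓ * x ^ (Δ + (n : ℝ))) =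
      fun n : ℕ => diagCoeff k (n + ℓ) * x ^ (((n + ℓ : ℕ) : ℝ) + (Δ - (ℓ : ℝ))) := by
    funext n
    rw [hkeq, add_comm n ℓ, diagCoeff_hrMonomialCoeff]
    congr 1
    push_cast
    ring_nf
  rw [hfun]
  exact hd

/-- The same as an equation: `g(x,x) = Σ'_n (hrLevelSum Δ ℓ n / λ_ℓ) x^{Δ+n}`.
[cite: HogervorstRychkov2013, §3 eqs. (3.4), (3.9)] -/
theorem IsConformalBlock3D.diag_eq_tsum_hr {Δ : ℝ} {ℓ : ℕ} {g : ℝ → ℝ → ℝ}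
    (hΔ : unitarityBound3D ℓ < Δ) (hreg : ¬ accidentalDegeneracy3D Δ ℓ)
    (h : IsConformalBlock3D 0 0 Δ ℓ g) {x : ℝ} (hx : x ∈ Ioo (0 : ℝ) 1) :
    g x x = ∑' n : ℕ, hrLevelSum Δ ℓ n / legendreLam ℓ * x ^ (Δ + (n : ℝ)) :=
  (h.hasSum_diag_hr hΔ hreg hx).tsum_eq.symm

/-- **Every partial sum is a lower bound** for the diagonal of a genuine block (all terms are
nonnegative): the enclosure's lower half. [cite: HogervorstRychkov2013, §3 eq. (3.9)] -/
theorem IsConformalBlock3D.sum_range_le_diag {Δ : ℝ} {ℓ : ℕ} {g : ℝ → ℝ → ℝ}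
    (hΔ : unitarityBound3D ℓ < Δ) (hreg : ¬ accidentalDegeneracy3D Δ ℓ)
    (h : IsConformalBlock3D 0 0 Δ ℓ g) {x : ℝ} (hx : x ∈ Ioo (0 : ℝ) 1) (M : ℕ) :
    ∑ n ∈ range M, hrLevelSum Δ ℓ n / legendreLam ℓ * x ^ (Δ + (n : ℝ)) ≤ g x x := by
  refine sum_le_hasSum (range M) (fun n _ => ?_) (h.hasSum_diag_hr hΔ hreg hx)
  exact mul_nonneg (div_nonneg (hrLevelSum_nonneg hΔ n) (legendreLam_pos ℓ).le)
    (Real.rpow_nonneg hx.1.le _)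

end Literature.MathematicalPhysics.QuantumFieldTheory.ConformalBootstrap3D
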